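import Summits.ResolutionOfSingularities.ResolutionOfSingularities.Theorems.FrobeniusLadderFInjectiveMacaulayficationODPCurveBlowupRegular
import HarnessLib

/-!
# The centre `(x′, y, g)` of the rank-one double-point family `x′² + y·g = 0` in `Λ[x′, y]`: quotient `Λ/(g)`, quasi-regularity, `h ∈ I²`, the reduction `(y, g)`
# (T″-side second kernel instance (RR-I2) — the point floor of `x² + y³ + u³ + t³ + s³`, transversal type A₁ along the Fermat-cubic surface; part 1 of the generic
# package; crux `FInjectiveMacaulayfication` stmt-ResolutionOfSingularities-15315, chain w45a; bed memo `Cruxes/…/Lines/RR-I2-bed-x2y3u3t3s3.md`; template =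
# res-L1-w45a-stub-1's `ODPCurveCentre` (the split family `a′b′ + w·g`); seat res-L1-w45a-lead-1 g11)

[OURS · L1 W4.5a] Support file (`--supports stmt-ResolutionOfSingularities-15315 --as helper`); replaces the role of NO printed item; NOT a statement of any
manuscript; def-free; UNCONDITIONAL; pure commutative algebra. AI-written (AI review is weaker than expert review).

SETTING (generic). `Λ` a commutative ring, `g ∈ Λ`, `R = Λ[T₀, T₁]` (`MvPolynomial (Fin 2) Λ`; `T₀ = x′`, `T₁ = y`), the CENTRE `cen = (T₀, T₁, C g) : Fin 3 → R`,
`I = (cen)`, and the hypersurface `h = T₀² + T₁·C g ∈ I²` — the NON-split rank-one twin of `ODPCurveCentre`'s `T₀T₁ + T₂·C g`. On the point floor of the (RR-I2) bed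
(`Λ = k[u′, t′, s′]`, `g = 1 + u′³ + t′³ + s′³`, any characteristic with `3 ≠ 0`) `R/(h)` is the `y`-chart `x′² + y(1 + u′³ + t′³ + s′³)` of `Bl_𝔪 {x² + y³ + u³ + t³ + s³ = 0}`
(res-L1-w45a-lead-1 g10 ✓ `X2Cubic4PointFloor`, chart `g₀`) and `V(I)` is its singular locus, the smooth affine Fermat cubic SURFACE `Σ`.
* §1 `span_range_cen_eq` — `I = (T₀, T₁) + g·R`; `exists_ringEquiv_quotient` — `R/I ≃+* Λ/(g)` with `C λ ↦ λ̄`; hence `isDomain_quotient`, `isRegularRing_quotient`,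
  `span_range_cen_ne_top`.
* §2 `isWeaklyRegular_cen` — `T₀, T₁, C g` is an `R`-sequence as soon as `g` is a non-zero-divisor of `Λ`; `isQuasiRegular_cen`.
* §3 `h_mem_sq` — `h ∈ I²`; `h_eq_odp` — `h = cen 1 · cen 2 + cen 0 · cen 0` (the ODP family `x_p x_{p′} + x_q x_{q′}` of `StrictTransformGraphType` §4 at
  `(p,p′,q,q′) = (1,2,0,0)`, `(2,1,0,0)` — the index conditions there do NOT require `q ≠ q′`); `h_ne_zero`; `not_isRegularLocalRing_of_le` — every prime `P ⊇ Ī` of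
  `R/(h)` is a SINGULAR point (`h ∈ P²`, Matsumura 14.2); `mk_cen_zero_sq` — `c̄₀² = −c̄₁·c̄₂` in `R/(h)`, whence (generic `sq_le_span_mul_of_sq_eq` for any `c : Fin 3 → A` with
  `c₀² = −c₁c₂`) ★ `map_sq_le_span_mul` — **`J² ≤ (c̄₁, c̄₂)·J`**, `J = Ī`: the two generators `(y, g)` are a REDUCTION of the centre, so the `x′`-chart of `Bl_J` is
  covered by the other two (GW 13.91 (4) form used by `affineBlowup.isRegular_of_isRegularRing_blowupAlgebra_of_pow_le`).
[folklore; cite: Matsumura1987, Thm. 16.1, Thm. 16.2 (i), Thm. 14.2] [cite: StacksProject, Tag 0BIQ] [cite: GortzWedhorn2020, Prop. 13.91 (4)]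
-/

-- single-problem summit: the doubled namespace component is forced
set_option linter.dupNamespace false

noncomputable section

namespace Summit.ResolutionOfSingularities.ResolutionOfSingularities.Theorems.FInjectiveMacaulayfication.X2YGCentre

open MvPolynomial Literature.AlgebraicGeometry.Resolution

universe u

variable {Λ : Type u} [CommRing Λ] (g : Λ) (cen : Fin 3 → MvPolynomial (Fin 2) Λ)

/-! ## §1 The centre ideal: the two variables plus a constant -/

/-- The values of the centre. [plumbing] -/
theorem cen_apply (hcen : cen = ![X 0, X 1, C g]) : cen 0 = X 0 ∧ cen 1 = X 1 ∧ cen 2 = C g := by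
  subst hcen
  exact ⟨rfl, rfl, rfl⟩

/-- **`I = (T₀, T₁) + g·R`**: the centre ideal is generated by all the variables and the constant `g`. [folklore] -/
theorem span_range_cen_eq (hcen : cen = ![X 0, X 1, C g]) :
    Ideal.span (Set.range cen) =
      Ideal.span (X '' (Set.univ : Set (Fin 2)) : Set (MvPolynomial (Fin 2) Λ)) ⊔
        (Ideal.span {g}).map (C : Λ →+* MvPolynomial (Fin 2) Λ) := by
  obtain ⟨h0, h1, h2⟩ := cen_apply g cen hcen
  apply le_antisymm
  · rw [Ideal.span_le]
    rintro _ ⟨j, rfl⟩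
    rcases Fin.eq_zero_or_eq_succ j with rfl | ⟨j, rfl⟩
    · rw [h0]; exact MvPolynomial.X_mem_span_X_image_sup_map_C _ _ (Set.mem_univ (0 : Fin 2))
    rcases Fin.eq_zero_or_eq_succ j with rfl | ⟨j, rfl⟩
    · rw [show ((0 : Fin 2).succ : Fin 3) = 1 from rfl, h1]
      exact MvPolynomial.X_mem_span_X_image_sup_map_C _ _ (Set.mem_univ (1 : Fin 2))
    · rw [Fin.eq_zero j, show ((0 : Fin 1).succ.succ : Fin 3) = 2 from rfl, h2]
      exact MvPolynomial.C_mem_span_X_image_sup_map_C _ _ (Ideal.subset_span rfl)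
  · refine sup_le (Ideal.span_mono ?_) ?_
    · rintro _ ⟨j, -, rfl⟩
      fin_cases j
      · exact ⟨0, h0⟩
      · exact ⟨1, h1⟩
    · rw [Ideal.map_span, Set.image_singleton, Ideal.span_le, Set.singleton_subset_iff]
      exact Ideal.subset_span ⟨2, h2⟩

/-- **`R/I ≃+* Λ/(g)`**, `C λ ↦ λ̄` (kill the variables: `R/((T) + gR) ≅ (Λ/(g))[T]/(T) ≅ (Λ/(g))[∅] ≅ Λ/(g)`). [folklore] -/
theorem exists_ringEquiv_quotient (hcen : cen = ![X 0, X 1, C g]) :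
    ∃ e : (MvPolynomial (Fin 2) Λ ⧸ Ideal.span (Set.range cen)) ≃+* (Λ ⧸ Ideal.span {g}),
      ∀ c : Λ, e (Ideal.Quotient.mk _ (C c)) = Ideal.Quotient.mk _ c := by
  haveI : IsEmpty {j : Fin 2 // j ∉ (Set.univ : Set (Fin 2))} := ⟨fun j => j.2 (Set.mem_univ _)⟩
  have hI := (span_range_cen_eq g cen hcen).trans (MvPolynomial.ker_quotient_comp_map_eq (Set.univ : Set (Fin 2)) (Ideal.span {g})).symm
  let e1 : (MvPolynomial (Fin 2) Λ ⧸ Ideal.span (Set.range cen)) ≃+*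
      (MvPolynomial (Fin 2) (Λ ⧸ Ideal.span {g}) ⧸ Ideal.span (X '' (Set.univ : Set (Fin 2)) : Set (MvPolynomial (Fin 2) (Λ ⧸ Ideal.span {g})))) :=
    (Ideal.quotEquivOfEq hI).trans
      (RingHom.quotientKerEquivOfSurjective (MvPolynomial.quotient_comp_map_surjective (Set.univ : Set (Fin 2)) (Ideal.span {g})))
  let e2 := (MvPolynomial.quotientSpanXEquiv (R := Λ ⧸ Ideal.span {g}) (Set.univ : Set (Fin 2))).toRingEquiv
  let e3 := (MvPolynomial.isEmptyAlgEquiv (Λ ⧸ Ideal.span {g}) {j : Fin 2 // j ∉ (Set.univ : Set (Fin 2))}).toRingEquiv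
  refine ⟨e1.trans (e2.trans e3), fun c => ?_⟩
  have h1 : e1 (Ideal.Quotient.mk _ (C c)) = Ideal.Quotient.mk _ (C (Ideal.Quotient.mk (Ideal.span {g}) c)) := by
    change ((Ideal.Quotient.mk _).comp (MvPolynomial.map (Ideal.Quotient.mk (Ideal.span {g})))) (C c) = _
    rw [RingHom.comp_apply, MvPolynomial.map_C]
  rw [RingEquiv.trans_apply, RingEquiv.trans_apply, h1]
  change e3 (MvPolynomial.quotientSpanXEquiv (R := Λ ⧸ Ideal.span {g}) (Set.univ : Set (Fin 2)) (Ideal.Quotient.mk _ (C _))) = _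
  rw [MvPolynomial.quotientSpanXEquiv_mk_C]
  change MvPolynomial.isEmptyAlgEquiv (Λ ⧸ Ideal.span {g}) _ (C _) = _
  rw [← MvPolynomial.algebraMap_eq, AlgEquiv.commutes]
  rfl

/-- `R/I` is a domain when `Λ/(g)` is. [folklore] -/
theorem isDomain_quotient (hcen : cen = ![X 0, X 1, C g]) [IsDomain (Λ ⧸ Ideal.span {g})] :
    IsDomain (MvPolynomial (Fin 2) Λ ⧸ Ideal.span (Set.range cen)) := by
  obtain ⟨e, -⟩ := exists_ringEquiv_quotient g cen hcen
  exact e.toMulEquiv.isDomain _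

/-- `R/I` is a regular ring when `Λ/(g)` is. [folklore] -/
theorem isRegularRing_quotient (hcen : cen = ![X 0, X 1, C g]) [IsRegularRing (Λ ⧸ Ideal.span {g})] :
    IsRegularRing (MvPolynomial (Fin 2) Λ ⧸ Ideal.span (Set.range cen)) := by
  obtain ⟨e, -⟩ := exists_ringEquiv_quotient g cen hcen
  exact IsRegularRing.of_ringEquiv (R := Λ ⧸ Ideal.span {g}) e.symm

/-- `I ≠ R` when `(g) ≠ Λ`. [folklore] -/
theorem span_range_cen_ne_top (hcen : cen = ![X 0, X 1, C g]) (hg : Ideal.span {g} ≠ ⊤) :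
    Ideal.span (Set.range cen) ≠ ⊤ := by
  obtain ⟨e, -⟩ := exists_ringEquiv_quotient g cen hcen
  haveI : Nontrivial (Λ ⧸ Ideal.span {g}) := Ideal.Quotient.nontrivial_iff.mpr hg
  haveI : Nontrivial (MvPolynomial (Fin 2) Λ ⧸ Ideal.span (Set.range cen)) := e.toEquiv.nontrivial
  exact Ideal.Quotient.nontrivial_iff.mp inferInstance

/-! ## §2 The centre is an `R`-sequence, hence quasi-regular -/

/-- **`T₀, T₁, C g` is a weakly regular sequence on `R = Λ[T₀, T₁]`** when `g` is a non-zero-divisor of `Λ`: distinct variables are weakly regular on any polynomial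
ring, and modulo both of them `C g` acts on `R/(T) ≅ Λ` as `g`. [folklore; cite: Matsumura1987, Thm. 16.1] -/
theorem isWeaklyRegular_cen (hcen : cen = ![X 0, X 1, C g]) (hg : IsSMulRegular Λ g) :
    RingTheory.Sequence.IsWeaklyRegular (MvPolynomial (Fin 2) Λ) (List.ofFn cen) := by
  subst hcen
  have hl : List.ofFn (![X 0, X 1, C g] : Fin 3 → MvPolynomial (Fin 2) Λ) = [X 0, X 1] ++ [C g] := rfl
  rw [hl, RingTheory.Sequence.isWeaklyRegular_append_iff]
  constructor
  · -- the variables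
    have := MvPolynomial.isWeaklyRegular_map_X (R := Λ) (τ := Fin 2) [0, 1] (by decide)
    exact this
  · -- modulo the variables: `C g` acts on `R/(T₀, T₁) ≅ Λ[∅]` as the non-zero-divisor `C g`
    have hideal : (Ideal.ofList [(X 0 : MvPolynomial (Fin 2) Λ), X 1] • ⊤ :
        Submodule (MvPolynomial (Fin 2) Λ) (MvPolynomial (Fin 2) Λ)) =
          Ideal.span (X '' (Set.univ : Set (Fin 2)) : Set (MvPolynomial (Fin 2) Λ)) := by
      rw [smul_eq_mul, Ideal.mul_top, Ideal.ofList]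
      congr 1
      ext p
      simp only [Set.mem_setOf_eq, List.mem_cons, List.not_mem_nil, or_false, Set.mem_image, Set.mem_univ, true_and]
      constructor
      · rintro (rfl | rfl)
        · exact ⟨0, rfl⟩
        · exact ⟨1, rfl⟩
      · rintro ⟨j, rfl⟩
        fin_cases j
        · exact Or.inl rfl
        · exact Or.inr rfl
    rw [hideal, RingTheory.Sequence.isWeaklyRegular_singleton_iff]
    -- regularity of `C g` on the quotient RING `R/(T)`, read through `R/(T) ≅ Λ[T_∅]`
    apply isSMulRegular_quotient_of_isLeftRegular
    let ε := MvPolynomial.quotientSpanXEquiv (R := Λ) (Set.univ : Set (Fin 2))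
    have hC : IsLeftRegular (C g : MvPolynomial {j : Fin 2 // j ∉ (Set.univ : Set (Fin 2))} Λ) := by
      intro p q hpq
      ext m
      have := congrArg (coeff m) hpq
      simp only [coeff_C_mul] at this
      exact hg this
    intro a b hab
    apply ε.injective
    apply hC
    have := congrArg ε hab
    simp only [map_mul] at this
    rwa [MvPolynomial.quotientSpanXEquiv_mk_C] at this

/-- ★ **The centre `(T₀, T₁, C g)` is quasi-regular** (`g` a non-zero-divisor of `Λ`). [cite: Matsumura1987, Thm. 16.2 (i)] -/
theorem isQuasiRegular_cen (hcen : cen = ![X 0, X 1, C g]) (hg : IsSMulRegular Λ g) : IsQuasiRegular cen :=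
  isQuasiRegular_of_isWeaklyRegular cen (isWeaklyRegular_cen g cen hcen hg)

/-! ## §3 The hypersurface `h = T₀² + T₁·C g` -/

variable (h : MvPolynomial (Fin 2) Λ)

/-- `h ∈ I²`. [folklore] -/
theorem h_mem_sq (hcen : cen = ![X 0, X 1, C g]) (hh : h = X 0 ^ 2 + X 1 * C g) :
    h ∈ Ideal.span (Set.range cen) ^ 2 := by
  obtain ⟨h0, h1, h2⟩ := cen_apply g cen hcen
  have hm : ∀ j, cen j ∈ Ideal.span (Set.range cen) := fun j => Ideal.subset_span ⟨j, rfl⟩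
  rw [hh, pow_two, pow_two, ← h0, ← h1, ← h2]
  exact Ideal.add_mem _ (Ideal.mul_mem_mul (hm 0) (hm 0)) (Ideal.mul_mem_mul (hm 1) (hm 2))

/-- **`h` as the ODP family `x_p x_{p′} + x_q x_{q′}`** of `StrictTransformGraphType` §4, on the two charts `p = 1, 2` (`(p, p′, q, q′) = (1,2,0,0), (2,1,0,0)`; the
chart `p = 0` is not needed, §3 `map_sq_le_span_mul`). [plumbing] -/
theorem h_eq_odp (hcen : cen = ![X 0, X 1, C g]) (hh : h = X 0 ^ 2 + X 1 * C g) :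
    h = cen 1 * cen 2 + cen 0 * cen 0 ∧ h = cen 2 * cen 1 + cen 0 * cen 0 := by
  obtain ⟨h0, h1, h2⟩ := cen_apply g cen hcen
  rw [hh, h0, h1, h2]
  exact ⟨by ring, by ring⟩

/-- `h ≠ 0` as soon as `g ≠ 0` (evaluate at `T₀ = 0`, `T₁ = 1`). [plumbing] -/
theorem h_ne_zero (hg0 : g ≠ 0) (hh : h = X 0 ^ 2 + X 1 * C g) : h ≠ 0 := by
  have hev : MvPolynomial.eval ![(0 : Λ), 1] h = g := by
    rw [hh]
    simp only [map_add, map_mul, map_pow, eval_X, eval_C, Matrix.cons_val_zero, Matrix.cons_val_one]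
    simp
  intro h0
  rw [h0, map_zero] at hev
  exact hg0 hev.symm

/-- ★ **Every point of `V(Ī) ⊂ Spec R/(h)` is singular**: for `Λ` a regular domain, `g ≠ 0`, and a prime `P ⊇ Ī` of `R/(h)`, the local ring `(R/(h))_P` is NOT
regular — `0 ≠ h ∈ I² ⊆ 𝔓²` for the preimage `𝔓 ⊇ I` (Matsumura 14.2, `not_isRegularLocalRing_localization_quotient_of_mem_sq`). [cite: Matsumura1987, Thm. 14.2] -/
theorem not_isRegularLocalRing_of_le [IsRegularRing Λ] [IsDomain Λ] (hg0 : g ≠ 0) (hcen : cen = ![X 0, X 1, C g])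
    (hh : h = X 0 ^ 2 + X 1 * C g) (P : Ideal (MvPolynomial (Fin 2) Λ ⧸ Ideal.span {h})) [P.IsPrime]
    (hP : (Ideal.span (Set.range cen)).map (Ideal.Quotient.mk (Ideal.span {h})) ≤ P) :
    ¬ IsRegularLocalRing (Localization.AtPrime P) := by
  refine not_isRegularLocalRing_localization_quotient_of_mem_sq (h_ne_zero g h hg0 hh) P ?_
  have hle : Ideal.span (Set.range cen) ≤ P.comap (Ideal.Quotient.mk (Ideal.span {h})) := by
    rw [← Ideal.map_le_iff_le_comap]; exact hP
  exact Ideal.pow_right_mono hle 2 (h_mem_sq g cen h hcen hh)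

/-- **`c̄₀² = −c̄₁·c̄₂` in `R/(h)`** (`h = c₀² + c₁c₂`). [plumbing] -/
theorem mk_cen_zero_sq (hcen : cen = ![X 0, X 1, C g]) (hh : h = X 0 ^ 2 + X 1 * C g) :
    Ideal.Quotient.mk (Ideal.span {h}) (cen 0) ^ 2 =
      -(Ideal.Quotient.mk (Ideal.span {h}) (cen 1) * Ideal.Quotient.mk (Ideal.span {h}) (cen 2)) := by
  obtain ⟨h0, h1, h2⟩ := cen_apply g cen hcen
  rw [← map_pow, ← map_mul, ← map_neg, Ideal.Quotient.eq, Ideal.mem_span_singleton]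
  refine ⟨1, ?_⟩
  rw [h0, h1, h2, hh]
  ring

/-- ★ **`(c)² ≤ (c₁, c₂)·(c)` whenever `c₀² = −c₁c₂`** (any commutative ring `A`, `c : Fin 3 → A`): the two generators `c₁, c₂` are a REDUCTION of `(c₀, c₁, c₂)`
with reduction number `1` — all products of two generators lie in `(c₁, c₂)·(c)`, the only non-obvious one being `c₀·c₀ = −c₁c₂`. Stated in the form consumed by
`affineBlowup.isRegular_of_isRegularRing_blowupAlgebra_of_pow_le` (`N = 1`, `x = (c₁, c₂)`): the `c₀`-chart of `Bl_{(c)}` is covered by the other two.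
[folklore; cite: GortzWedhorn2020, Prop. 13.91 (4)] -/
theorem sq_le_span_mul_of_sq_eq {A : Type u} [CommRing A] (c : Fin 3 → A) (hrel : c 0 ^ 2 = -(c 1 * c 2)) :
    Ideal.span (Set.range c) ^ (1 + 1) ≤ Ideal.span (Set.range ![c 1, c 2]) * Ideal.span (Set.range c) ^ 1 := by
  rw [pow_one, pow_two, Ideal.span_mul_span', Ideal.span_le]
  intro z hz
  obtain ⟨a, ha, b, hb, rfl⟩ := Set.mem_mul.mp hz
  obtain ⟨i, rfl⟩ := ha
  obtain ⟨j, rfl⟩ := hb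
  have hm1 : c 1 ∈ Ideal.span (Set.range ![c 1, c 2]) := Ideal.subset_span ⟨0, rfl⟩
  have hm2 : c 2 ∈ Ideal.span (Set.range ![c 1, c 2]) := Ideal.subset_span ⟨1, rfl⟩
  have hJ : ∀ l, c l ∈ Ideal.span (Set.range c) := fun l => Ideal.subset_span ⟨l, rfl⟩
  show c i * c j ∈ Ideal.span (Set.range ![c 1, c 2]) * Ideal.span (Set.range c)
  fin_cases i <;> fin_cases j
  · -- `c₀ c₀ = -(c₁ c₂)`
    show c 0 * c 0 ∈ _
    rw [← pow_two, hrel]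
    exact (Ideal.neg_mem_iff _).mpr (Ideal.mul_mem_mul hm1 (hJ 2))
  · show c 0 * c 1 ∈ _
    rw [mul_comm (c 0)]; exact Ideal.mul_mem_mul hm1 (hJ 0)
  · show c 0 * c 2 ∈ _
    rw [mul_comm (c 0)]; exact Ideal.mul_mem_mul hm2 (hJ 0)
  · exact Ideal.mul_mem_mul hm1 (hJ 0)
  · exact Ideal.mul_mem_mul hm1 (hJ 1)
  · exact Ideal.mul_mem_mul hm1 (hJ 2)
  · exact Ideal.mul_mem_mul hm2 (hJ 0)
  · exact Ideal.mul_mem_mul hm2 (hJ 1)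
  · exact Ideal.mul_mem_mul hm2 (hJ 2)

/-- `J = Ī = (c̄₀, c̄₁, c̄₂)` as the span of the images of the generators. [plumbing] -/
theorem map_span_range_cen_eq :
    (Ideal.span (Set.range cen)).map (Ideal.Quotient.mk (Ideal.span {h})) =
      Ideal.span (Set.range fun l => Ideal.Quotient.mk (Ideal.span {h}) (cen l)) := by
  rw [Ideal.map_span, ← Set.range_comp]
  rfl

/-- ★ **`J² ≤ (c̄₁, c̄₂)·J`** for `J = Ī ⊆ R/(h)`: the generators `(y, g)` are a REDUCTION of the centre `(x′, y, g)` — so `Bl_J` is covered by the `y`- and `g`-charts and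
the `x′`-chart never has to be inspected. [folklore; cite: GortzWedhorn2020, Prop. 13.91 (4)] -/
theorem map_sq_le_span_mul (hcen : cen = ![X 0, X 1, C g]) (hh : h = X 0 ^ 2 + X 1 * C g) :
    (Ideal.span (Set.range cen)).map (Ideal.Quotient.mk (Ideal.span {h})) ^ (1 + 1) ≤
      Ideal.span (Set.range ![Ideal.Quotient.mk (Ideal.span {h}) (cen 1), Ideal.Quotient.mk (Ideal.span {h}) (cen 2)]) *
        (Ideal.span (Set.range cen)).map (Ideal.Quotient.mk (Ideal.span {h})) ^ 1 := by
  rw [map_span_range_cen_eq cen h]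
  exact sq_le_span_mul_of_sq_eq (fun l => Ideal.Quotient.mk (Ideal.span {h}) (cen l)) (mk_cen_zero_sq g cen h hcen hh)

end Summit.ResolutionOfSingularities.ResolutionOfSingularities.Theorems.FInjectiveMacaulayfication.X2YGCentre

end
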